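import Mathlib.Analysis.SpecialFunctions.ImproperIntegrals
import Mathlib.MeasureTheory.Integral.ExpDecay
import Mathlib.MeasureTheory.Measure.Lebesgue.Integral
import Mathlib.Analysis.SpecialFunctions.Trigonometric.Basic

/-!
# RiemannHypothesis / UniversalFactor — `NarrowKernelNoGo`, line `Sketch`, stub K1a (energy lower
bound): the tilted Laplace kernel `κ_a(u) = e^{−2a|u|} e^{−πu/4}`

Route `RiemannHypothesis/UniversalFactor`, crux `NarrowKernelNoGo` (stmt-RiemannHypothesis-2576), stub
`UniversalFactor.stub_narrowEnergyLower` (lead). On the critical line the Laplace(a)-smoothing reads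
`F_a(2t) t^{-7/4} e^{πt/4} ≈ −(a/8) c₀ ∫ κ_a(u) Z(t+u) du` with the TILTED kernel
`κ_a(u) = e^{−2a|u| − πu/4}` (the tilt `e^{−πu/4}` is the ratio of the `ξ`-envelopes
`E(t+u)/E(t)`); `κ_a ∈ L¹` iff `a > π/8`. This file (pure real/complex calculus, sorry-free):

* `UniversalFactor.narrowKer_le_exp` — `κ_a(u) ≤ e^{−c|u|}`, `c = 2a − π/4 > 0`;
* `UniversalFactor.narrow_one_add_abs_pow_mul_exp_le` — `(1+|u|)^k e^{−c|u|} ≤ (2k/c)^k e^{−c|u|/2}`;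
* integrability of `(1+|u|)^k κ_a(u)` and exponential tail bounds `∫_{|u|>R} ≤ C e^{−cR/4}`;
* `UniversalFactor.narrowKer_fourier` (registered sub-stub; `…_of` is the working form) — the closed form
  `∫ κ_a(u) e^{iωu} du = 1/(2a + π/4 − iω) + 1/(2a − π/4 + iω)`, and the two-sided size bounds
  `4a/((2a+π/4+|ω|)²) ≤ |κ̂_a(ω)| ≤ ∫ κ_a`.

References: Titchmarsh, *The Theory of the Riemann Zeta-Function* (1986), §7.3 (smoothed mean
values); crux idea card `lorentz-filter-energy-gap` (Cruxes/NarrowKernelNoGo/Ideas).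
-/

noncomputable section

-- D-0017: `Summit.<S>.<S>.…` is the designed namespace of a single-problem summit.
set_option linter.dupNamespace false

namespace Summit.RiemannHypothesis.RiemannHypothesis.Theorems

open MeasureTheory Set Filter Complex intervalIntegral
open scoped Real Topology

/-! ## Pointwise bounds for the tilted kernel -/

/-- The decay rate `c = 2a − π/4` of the tilted kernel is positive for `a > π/8`. [folklore] -/
theorem UniversalFactor.narrowKer_rate_pos {a : ℝ} (ha : π / 8 < a) : 0 < 2 * a - π / 4 := by
  linarith

/-- `κ_a(u) = e^{−2a|u|} e^{−πu/4} ≤ e^{−(2a − π/4)|u|}`. [folklore] -/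
theorem UniversalFactor.narrowKer_le_exp (a u : ℝ) :
    Real.exp (-(2 * a * |u|)) * Real.exp (-(π * u / 4)) ≤ Real.exp (-((2 * a - π / 4) * |u|)) := by
  rw [← Real.exp_add]
  apply Real.exp_le_exp.2
  have h1 : -(π * u / 4) ≤ π / 4 * |u| := by
    have hπ : 0 < π := Real.pi_pos
    have := neg_abs_le u
    nlinarith
  nlinarith

/-- `κ_a(u) > 0`. [folklore] -/
theorem UniversalFactor.narrowKer_pos (a u : ℝ) :
    0 < Real.exp (-(2 * a * |u|)) * Real.exp (-(π * u / 4)) :=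
  mul_pos (Real.exp_pos _) (Real.exp_pos _)

/-- The tilted kernel is continuous. [folklore] -/
theorem UniversalFactor.continuous_narrowKer (a : ℝ) :
    Continuous fun u : ℝ => Real.exp (-(2 * a * |u|)) * Real.exp (-(π * u / 4)) := by
  fun_prop

/-- `1 + x ≤ e^{εx}/ε` for `0 < ε ≤ 1` (all real `x`). [folklore] -/
theorem UniversalFactor.narrow_one_add_le_exp_div {ε : ℝ} (hε : 0 < ε) (hε1 : ε ≤ 1) (x : ℝ) :
    1 + x ≤ Real.exp (ε * x) / ε := by
  rw [le_div_iff₀ hε]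
  have h1 : ε * x + 1 ≤ Real.exp (ε * x) := Real.add_one_le_exp _
  nlinarith

/-- `(1 + |u|)^k e^{−c|u|} ≤ ε^{-k} e^{−(c − kε)|u|}` for `0 < ε ≤ 1`. [folklore] -/
theorem UniversalFactor.narrow_one_add_abs_pow_mul_exp_le {ε : ℝ} (hε : 0 < ε) (hε1 : ε ≤ 1)
    (c : ℝ) (k : ℕ) (u : ℝ) :
    (1 + |u|) ^ k * Real.exp (-(c * |u|)) ≤ ε⁻¹ ^ k * Real.exp (-((c - k * ε) * |u|)) := by
  have h1 : 1 + |u| ≤ Real.exp (ε * |u|) / ε := UniversalFactor.narrow_one_add_le_exp_div hε hε1 |u|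
  have h2 : (1 + |u|) ^ k ≤ (Real.exp (ε * |u|) / ε) ^ k :=
    pow_le_pow_left₀ (by positivity) h1 k
  have h3 : (Real.exp (ε * |u|) / ε) ^ k = ε⁻¹ ^ k * Real.exp (k * ε * |u|) := by
    rw [div_eq_mul_inv, mul_pow, ← Real.exp_nat_mul, mul_comm]
    ring_nf
  calc (1 + |u|) ^ k * Real.exp (-(c * |u|))
      ≤ (Real.exp (ε * |u|) / ε) ^ k * Real.exp (-(c * |u|)) :=
        mul_le_mul_of_nonneg_right h2 (Real.exp_pos _).le
    _ = ε⁻¹ ^ k * Real.exp (-((c - k * ε) * |u|)) := by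
        rw [h3, mul_assoc, ← Real.exp_add]
        congr 1
        ring_nf

/-- For `c > 0` and `k`, `(1+|u|)^k e^{−c|u|} ≤ M_k e^{−c|u|/2}` with an explicit `M_k`
(`ε = min 1 (c/(2k+2))`). [folklore] -/
theorem UniversalFactor.narrow_one_add_abs_pow_mul_exp_le_half {c : ℝ} (hc : 0 < c) (k : ℕ) (u : ℝ) :
    (1 + |u|) ^ k * Real.exp (-(c * |u|)) ≤
      (min 1 (c / (2 * k + 2)))⁻¹ ^ k * Real.exp (-(c / 2 * |u|)) := by
  set ε : ℝ := min 1 (c / (2 * k + 2)) with hε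
  have hε0 : 0 < ε := lt_min one_pos (by positivity)
  have hε1 : ε ≤ 1 := min_le_left _ _
  have hεc : (k : ℝ) * ε ≤ c / 2 := by
    have h1 : ε ≤ c / (2 * k + 2) := min_le_right _ _
    have hk : (0 : ℝ) ≤ k := k.cast_nonneg
    calc (k : ℝ) * ε ≤ k * (c / (2 * k + 2)) := mul_le_mul_of_nonneg_left h1 hk
      _ ≤ c / 2 := by
          rw [mul_div_assoc']
          rw [div_le_div_iff₀ (by positivity) (by positivity)]
          nlinarith
  have h := UniversalFactor.narrow_one_add_abs_pow_mul_exp_le hε0 hε1 c k u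
  refine h.trans (mul_le_mul_of_nonneg_left ?_ (by positivity))
  apply Real.exp_le_exp.2
  have h0 : 0 ≤ |u| := abs_nonneg u
  nlinarith

/-! ## Integrability and tails -/

/-- `e^{−c|u|}` is integrable over `ℝ` for `c > 0` (the two half-lines). [folklore] -/
theorem UniversalFactor.narrow_integrable_exp_neg_mul_abs {c : ℝ} (hc : 0 < c) :
    Integrable fun u : ℝ => Real.exp (-(c * |u|)) := by
  have hIoi : IntegrableOn (fun y : ℝ => Real.exp (-(c * |y|))) (Ioi 0) :=
    (exp_neg_integrableOn_Ioi 0 hc).congr_fun (fun y hy => by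
      simp only [abs_of_pos (show (0 : ℝ) < y from hy), neg_mul]) measurableSet_Ioi
  have hIic : IntegrableOn (fun y : ℝ => Real.exp (-(c * |y|))) (Iic 0) := by
    rw [← Measure.map_neg_eq_self (volume : Measure ℝ)]
    let m : MeasurableEmbedding fun x : ℝ => -x := (Homeomorph.neg ℝ).measurableEmbedding
    rw [m.integrableOn_map_iff]
    simp_rw [Function.comp_def, abs_neg, neg_preimage, neg_Iic, neg_zero]
    exact Iff.mpr integrableOn_Ici_iff_integrableOn_Ioi hIoi
  have := hIic.union hIoi
  rwa [Iic_union_Ioi, integrableOn_univ] at this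

/-- `(1+|u|)^k κ_a(u)` is integrable over `ℝ` for `a > π/8`. [folklore] -/
theorem UniversalFactor.narrow_integrable_pow_mul_ker {a : ℝ} (ha : π / 8 < a) (k : ℕ) :
    Integrable fun u : ℝ => (1 + |u|) ^ k * (Real.exp (-(2 * a * |u|)) * Real.exp (-(π * u / 4))) := by
  set c : ℝ := 2 * a - π / 4 with hc
  have hc0 : 0 < c := UniversalFactor.narrowKer_rate_pos ha
  set M : ℝ := (min 1 (c / (2 * k + 2)))⁻¹ ^ k with hM
  have hint : Integrable fun u : ℝ => M * Real.exp (-(c / 2 * |u|)) :=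
    (UniversalFactor.narrow_integrable_exp_neg_mul_abs (by positivity : 0 < c / 2)).const_mul M
  refine hint.mono' (by fun_prop) (Eventually.of_forall fun u => ?_)
  have hpos : 0 ≤ (1 + |u|) ^ k * (Real.exp (-(2 * a * |u|)) * Real.exp (-(π * u / 4))) := by positivity
  rw [Real.norm_eq_abs, abs_of_nonneg hpos]
  calc (1 + |u|) ^ k * (Real.exp (-(2 * a * |u|)) * Real.exp (-(π * u / 4)))
      ≤ (1 + |u|) ^ k * Real.exp (-(c * |u|)) :=
        mul_le_mul_of_nonneg_left (UniversalFactor.narrowKer_le_exp a u) (by positivity)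
    _ ≤ M * Real.exp (-(c / 2 * |u|)) := UniversalFactor.narrow_one_add_abs_pow_mul_exp_le_half hc0 k u

/-- `κ_a` is integrable over `ℝ` for `a > π/8`. [folklore] -/
theorem UniversalFactor.narrow_integrable_ker {a : ℝ} (ha : π / 8 < a) :
    Integrable fun u : ℝ => Real.exp (-(2 * a * |u|)) * Real.exp (-(π * u / 4)) := by
  simpa using UniversalFactor.narrow_integrable_pow_mul_ker ha 0

/-- `∫ℝ e^{−c|u|} du ≤ 2/c`… in the weak form `∫_{|u| > R} e^{−c|u|} du ≤ (2/c) e^{−cR}` for `R ≥ 0`,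
`c > 0` (each half is `e^{−cR}/c`). [folklore] -/
theorem UniversalFactor.narrow_integral_exp_neg_mul_abs_tail {c R : ℝ} (hc : 0 < c) (hR : 0 ≤ R) :
    ∫ u in {u : ℝ | R < |u|}, Real.exp (-(c * |u|)) ≤ 2 / c * Real.exp (-(c * R)) := by
  -- `{R < |u|} = Iio (-R) ∪ Ioi R`
  have hset : {u : ℝ | R < |u|} = Iio (-R) ∪ Ioi R := by
    ext u
    simp only [mem_setOf_eq, mem_union, mem_Iio, mem_Ioi]
    constructor
    · intro h
      rcases lt_or_ge u 0 with hu | hu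
      · left; rw [abs_of_neg hu] at h; linarith
      · right; rwa [abs_of_nonneg hu] at h
    · rintro (h | h)
      · have : u < 0 := by linarith
        rw [abs_of_neg this]; linarith
      · have : 0 ≤ u := by linarith
        rwa [abs_of_nonneg this]
  have hint : Integrable fun u : ℝ => Real.exp (-(c * |u|)) := UniversalFactor.narrow_integrable_exp_neg_mul_abs hc
  have hdisj : Disjoint (Iio (-R)) (Ioi R) := by
    rw [Set.disjoint_iff]
    intro u ⟨h1, h2⟩
    simp only [mem_Iio, mem_Ioi] at h1 h2
    linarith
  rw [hset, setIntegral_union hdisj measurableSet_Ioi hint.integrableOn hint.integrableOn]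
  -- the right half
  have hIoi : ∫ u in Ioi R, Real.exp (-(c * |u|)) = Real.exp (-(c * R)) / c := by
    have h1 : ∫ u in Ioi R, Real.exp (-(c * |u|)) = ∫ u in Ioi R, Real.exp (-c * u) := by
      refine setIntegral_congr_fun measurableSet_Ioi fun u hu => ?_
      have : 0 ≤ u := hR.trans (le_of_lt hu)
      rw [abs_of_nonneg this]; ring_nf
    rw [h1, integral_exp_mul_Ioi (by linarith : -c < 0) R]
    field_simp
  -- the left half, by `u ↦ -u`
  have hIio : ∫ u in Iio (-R), Real.exp (-(c * |u|)) = Real.exp (-(c * R)) / c := by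
    have h1 : ∫ u in Iio (-R), Real.exp (-(c * |u|)) = ∫ u in Ioi R, Real.exp (-(c * |u|)) := by
      have h2 : ∫ u in Iic (-R), Real.exp (-(c * |u|)) = ∫ u in Iic (-R), Real.exp (-(c * |(-u)|)) := by
        simp only [abs_neg]
      rw [← integral_Iic_eq_integral_Iio, h2,
        integral_comp_neg_Iic (-R) (fun u : ℝ => Real.exp (-(c * |u|))), neg_neg]
    rw [h1, hIoi]
  rw [hIoi, hIio]
  have : Real.exp (-(c * R)) / c + Real.exp (-(c * R)) / c = 2 / c * Real.exp (-(c * R)) := by ring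
  rw [this]

/-- Exponential tail of `(1+|u|)^k κ_a`: `∫_{|u|>R} (1+|u|)^k κ_a(u) du ≤ M e^{−cR/2}` with
`c = 2a − π/4`, for `R ≥ 0`. [folklore] -/
theorem UniversalFactor.narrow_integral_pow_mul_ker_tail {a : ℝ} (ha : π / 8 < a) (k : ℕ) :
    ∃ M : ℝ, 0 < M ∧ ∀ R : ℝ, 0 ≤ R →
      ∫ u in {u : ℝ | R < |u|}, (1 + |u|) ^ k * (Real.exp (-(2 * a * |u|)) * Real.exp (-(π * u / 4))) ≤
        M * Real.exp (-((2 * a - π / 4) / 2 * R)) := by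
  set c : ℝ := 2 * a - π / 4 with hc
  have hc0 : 0 < c := UniversalFactor.narrowKer_rate_pos ha
  set M₀ : ℝ := (min 1 (c / (2 * k + 2)))⁻¹ ^ k with hM₀
  have hM₀pos : 0 < M₀ := by positivity
  refine ⟨M₀ * (2 / (c / 2)), by positivity, fun R hR => ?_⟩
  have hint := UniversalFactor.narrow_integrable_pow_mul_ker ha k
  have hint2 : Integrable fun u : ℝ => M₀ * Real.exp (-(c / 2 * |u|)) :=
    (UniversalFactor.narrow_integrable_exp_neg_mul_abs (by positivity : 0 < c / 2)).const_mul M₀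
  calc ∫ u in {u : ℝ | R < |u|}, (1 + |u|) ^ k * (Real.exp (-(2 * a * |u|)) * Real.exp (-(π * u / 4)))
      ≤ ∫ u in {u : ℝ | R < |u|}, M₀ * Real.exp (-(c / 2 * |u|)) := by
        refine setIntegral_mono_on hint.integrableOn hint2.integrableOn
          (measurableSet_lt measurable_const continuous_abs.measurable) fun u _ => ?_
        calc (1 + |u|) ^ k * (Real.exp (-(2 * a * |u|)) * Real.exp (-(π * u / 4)))
            ≤ (1 + |u|) ^ k * Real.exp (-(c * |u|)) :=
              mul_le_mul_of_nonneg_left (UniversalFactor.narrowKer_le_exp a u) (by positivity)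
          _ ≤ M₀ * Real.exp (-(c / 2 * |u|)) := UniversalFactor.narrow_one_add_abs_pow_mul_exp_le_half hc0 k u
    _ = M₀ * ∫ u in {u : ℝ | R < |u|}, Real.exp (-(c / 2 * |u|)) := by
        rw [MeasureTheory.integral_const_mul]
    _ ≤ M₀ * (2 / (c / 2) * Real.exp (-(c / 2 * R))) :=
        mul_le_mul_of_nonneg_left
          (UniversalFactor.narrow_integral_exp_neg_mul_abs_tail (by positivity) hR) hM₀pos.le
    _ = M₀ * (2 / (c / 2)) * Real.exp (-((2 * a - π / 4) / 2 * R)) := by rw [hc]; ring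

/-! ## The Fourier transform of the tilted kernel -/

/-- **Closed form**: `∫ℝ κ_a(u) e^{iωu} du = 1/(2a + π/4 − iω) + 1/(2a − π/4 + iω)` for `a > π/8`
(two exponential integrals on half-lines). [folklore] -/
theorem UniversalFactor.narrowKer_fourier_of {a : ℝ} (ha : π / 8 < a) (ω : ℝ) :
    ∫ u : ℝ, ((Real.exp (-(2 * a * |u|)) * Real.exp (-(π * u / 4)) : ℝ) : ℂ) * cexp (I * ω * u) =
      1 / ((2 * a + π / 4 : ℝ) - I * ω) + 1 / ((2 * a - π / 4 : ℝ) + I * ω) := by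
  have hc0 : 0 < 2 * a - π / 4 := UniversalFactor.narrowKer_rate_pos ha
  have hπ : 0 < π := Real.pi_pos
  set f : ℝ → ℂ := fun u => ((Real.exp (-(2 * a * |u|)) * Real.exp (-(π * u / 4)) : ℝ) : ℂ) * cexp (I * ω * u)
    with hf
  -- the two exponents
  set cp : ℂ := -((2 * a + π / 4 : ℝ) : ℂ) + I * ω with hcp
  set cm : ℂ := ((2 * a - π / 4 : ℝ) : ℂ) + I * ω with hcm
  have hcp_re : cp.re = -(2 * a + π / 4) := by simp [hcp]
  have hcm_re : cm.re = 2 * a - π / 4 := by simp [hcm]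
  have hcp_neg : cp.re < 0 := by rw [hcp_re]; linarith
  have hcm_pos : 0 < cm.re := by rw [hcm_re]; exact hc0
  -- on `Ioi 0` the integrand is `exp(cp u)`, on `Iic 0` it is `exp(cm u)`
  have hIoi_eq : ∀ u ∈ Ioi (0:ℝ), f u = cexp (cp * u) := by
    intro u hu
    have hu0 : 0 ≤ u := le_of_lt hu
    simp only [hf, abs_of_nonneg hu0, Complex.ofReal_mul, Complex.ofReal_exp, ← Complex.exp_add, hcp]
    congr 1
    push_cast
    ring
  have hIic_eq : ∀ u ∈ Iic (0:ℝ), f u = cexp (cm * u) := by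
    intro u hu
    have hu0 : u ≤ 0 := hu
    simp only [hf, abs_of_nonpos hu0, Complex.ofReal_mul, Complex.ofReal_exp, ← Complex.exp_add, hcm]
    congr 1
    push_cast
    ring
  have hint_Ioi : IntegrableOn f (Ioi 0) :=
    (integrableOn_exp_mul_complex_Ioi hcp_neg 0).congr_fun (fun u hu => (hIoi_eq u hu).symm)
      measurableSet_Ioi
  have hint_Iic : IntegrableOn f (Iic 0) :=
    (integrableOn_exp_mul_complex_Iic hcm_pos 0).congr_fun (fun u hu => (hIic_eq u hu).symm)
      measurableSet_Iic
  rw [← integral_Iic_add_Ioi hint_Iic hint_Ioi, setIntegral_congr_fun measurableSet_Iic hIic_eq,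
    setIntegral_congr_fun measurableSet_Ioi hIoi_eq, integral_exp_mul_complex_Iic hcm_pos 0,
    integral_exp_mul_complex_Ioi hcp_neg 0]
  simp only [Complex.ofReal_zero, mul_zero, Complex.exp_zero]
  have hcp_ne : cp ≠ 0 := fun h => by rw [h, Complex.zero_re] at hcp_neg; exact lt_irrefl 0 hcp_neg
  have hcm_ne : cm ≠ 0 := fun h => by rw [h, Complex.zero_re] at hcm_pos; exact lt_irrefl 0 hcm_pos
  have h1 : (-1 / cp : ℂ) = 1 / ((2 * a + π / 4 : ℝ) - I * ω) := by
    rw [hcp]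
    have : ((2 * a + π / 4 : ℝ) : ℂ) - I * ω = -(-((2 * a + π / 4 : ℝ) : ℂ) + I * ω) := by ring
    rw [this, div_neg, neg_div]
  rw [add_comm, h1, hcm]

/-- **Registered sub-stub `narrowKer_fourier`** (verbatim signature): the closed form of the
Fourier transform of the tilted Laplace kernel. [folklore] -/
theorem UniversalFactor.narrowKer_fourier : ∀ {a : ℝ}, Real.pi / 8 < a → ∀ ω : ℝ, ∫ u : ℝ, ((Real.exp (-(2 * a * |u|)) * Real.exp (-(Real.pi * u / 4)) : ℝ) : ℂ) * Complex.exp (Complex.I * ω * u) = 1 / ((2 * a + Real.pi / 4 : ℝ) - Complex.I * ω) + 1 / ((2 * a - Real.pi / 4 : ℝ) + Complex.I * ω) :=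
  fun ha ω => UniversalFactor.narrowKer_fourier_of ha ω

/-- The closed form is `4a/((2a + π/4 − iω)(2a − π/4 + iω))`. [folklore] -/
theorem UniversalFactor.narrowKer_fourier_eq_div {a : ℝ} (ha : π / 8 < a) (ω : ℝ) :
    (1 / ((2 * a + π / 4 : ℝ) - I * ω) + 1 / ((2 * a - π / 4 : ℝ) + I * ω) : ℂ) =
      (4 * a : ℝ) / ((((2 * a + π / 4 : ℝ) : ℂ) - I * ω) * (((2 * a - π / 4 : ℝ) : ℂ) + I * ω)) := by
  have hc0 : 0 < 2 * a - π / 4 := UniversalFactor.narrowKer_rate_pos ha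
  have hπ : 0 < π := Real.pi_pos
  have hp : (((2 * a + π / 4 : ℝ) : ℂ) - I * ω) ≠ 0 := by
    intro h
    have := congrArg Complex.re h
    simp at this
    linarith
  have hm : (((2 * a - π / 4 : ℝ) : ℂ) + I * ω) ≠ 0 := by
    intro h
    have := congrArg Complex.re h
    simp at this
    linarith
  rw [div_add_div _ _ hp hm, one_mul, mul_one]
  congr 1
  push_cast
  ring

/-- **Lower bound for the transform on a bounded frequency range**: for `|ω| ≤ W`,
`‖κ̂_a(ω)‖ ≥ 4a / (2a + π/4 + W)²`. [folklore] -/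
theorem UniversalFactor.norm_narrowKer_fourier_ge {a : ℝ} (ha : π / 8 < a) {ω W : ℝ} (hW : |ω| ≤ W) :
    4 * a / (2 * a + π / 4 + W) ^ 2 ≤
      ‖∫ u : ℝ, ((Real.exp (-(2 * a * |u|)) * Real.exp (-(π * u / 4)) : ℝ) : ℂ) * cexp (I * ω * u)‖ := by
  have hc0 : 0 < 2 * a - π / 4 := UniversalFactor.narrowKer_rate_pos ha
  have hπ : 0 < π := Real.pi_pos
  have ha0 : 0 < a := by linarith
  have hW0 : 0 ≤ W := (abs_nonneg ω).trans hW
  rw [UniversalFactor.narrowKer_fourier_of ha ω, UniversalFactor.narrowKer_fourier_eq_div ha ω, norm_div,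
    norm_mul, Complex.norm_real, Real.norm_eq_abs, abs_of_pos (by positivity : (0:ℝ) < 4 * a)]
  -- bound the two norms in the denominator
  have hnp : ‖((2 * a + π / 4 : ℝ) : ℂ) - I * ω‖ ≤ 2 * a + π / 4 + W := by
    calc ‖((2 * a + π / 4 : ℝ) : ℂ) - I * ω‖ ≤ ‖((2 * a + π / 4 : ℝ) : ℂ)‖ + ‖I * (ω : ℂ)‖ := norm_sub_le _ _
      _ = (2 * a + π / 4) + |ω| := by
          rw [Complex.norm_real, Real.norm_eq_abs, abs_of_pos (by positivity), norm_mul, Complex.norm_I,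
            one_mul, Complex.norm_real, Real.norm_eq_abs]
      _ ≤ 2 * a + π / 4 + W := by linarith
  have hnm : ‖((2 * a - π / 4 : ℝ) : ℂ) + I * ω‖ ≤ 2 * a + π / 4 + W := by
    calc ‖((2 * a - π / 4 : ℝ) : ℂ) + I * ω‖ ≤ ‖((2 * a - π / 4 : ℝ) : ℂ)‖ + ‖I * (ω : ℂ)‖ := norm_add_le _ _
      _ = (2 * a - π / 4) + |ω| := by
          rw [Complex.norm_real, Real.norm_eq_abs, abs_of_pos hc0, norm_mul, Complex.norm_I,
            one_mul, Complex.norm_real, Real.norm_eq_abs]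
      _ ≤ 2 * a + π / 4 + W := by linarith
  have hp0 : 0 < ‖((2 * a + π / 4 : ℝ) : ℂ) - I * ω‖ := by
    refine norm_pos_iff.2 fun h => ?_
    have := congrArg Complex.re h
    simp at this
    linarith
  have hm0 : 0 < ‖((2 * a - π / 4 : ℝ) : ℂ) + I * ω‖ := by
    refine norm_pos_iff.2 fun h => ?_
    have := congrArg Complex.re h
    simp at this
    linarith
  rw [div_le_div_iff₀ (by positivity) (mul_pos hp0 hm0)]
  have hprod : ‖((2 * a + π / 4 : ℝ) : ℂ) - I * ω‖ * ‖((2 * a - π / 4 : ℝ) : ℂ) + I * ω‖ ≤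
      (2 * a + π / 4 + W) ^ 2 := by
    rw [sq]
    exact mul_le_mul hnp hnm hm0.le (by positivity)
  nlinarith

/-- **Trivial upper bound**: `‖∫ κ_a(u) e^{iωu} g(u) du‖ ≤ ∫ κ_a` for any unimodular factor; here
`‖κ̂_a(ω)‖ ≤ ∫ℝ κ_a`. [folklore] -/
theorem UniversalFactor.norm_narrowKer_fourier_le (a ω : ℝ) :
    ‖∫ u : ℝ, ((Real.exp (-(2 * a * |u|)) * Real.exp (-(π * u / 4)) : ℝ) : ℂ) * cexp (I * ω * u)‖ ≤
      ∫ u : ℝ, Real.exp (-(2 * a * |u|)) * Real.exp (-(π * u / 4)) := by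
  refine (MeasureTheory.norm_integral_le_integral_norm _).trans (le_of_eq ?_)
  refine integral_congr_ae (Eventually.of_forall fun u => ?_)
  have hexp : ‖cexp (I * ω * u)‖ = 1 := by
    rw [show I * (ω : ℂ) * (u : ℂ) = ((ω * u : ℝ) : ℂ) * I by push_cast; ring, Complex.norm_exp_ofReal_mul_I]
  simp only [norm_mul, Complex.norm_real, Real.norm_eq_abs, hexp, mul_one,
    abs_of_pos (Real.exp_pos _)]

/-- The `L¹`-mass of `κ_a` is positive. [folklore] -/
theorem UniversalFactor.integral_narrowKer_pos {a : ℝ} (ha : π / 8 < a) :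
    0 < ∫ u : ℝ, Real.exp (-(2 * a * |u|)) * Real.exp (-(π * u / 4)) := by
  have := UniversalFactor.norm_narrowKer_fourier_ge ha (ω := 0) (W := 0) (by simp)
  have hc0 : 0 < 2 * a - π / 4 := UniversalFactor.narrowKer_rate_pos ha
  have hπ : 0 < π := Real.pi_pos
  have h4 : 0 < 4 * a / (2 * a + π / 4 + 0) ^ 2 := by
    have h5 : 0 < 2 * a + π / 4 + 0 := by linarith
    exact div_pos (by linarith) (pow_pos h5 2)
  exact lt_of_lt_of_le (lt_of_lt_of_le h4 this) (UniversalFactor.norm_narrowKer_fourier_le a 0)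

end Summit.RiemannHypothesis.RiemannHypothesis.Theorems
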